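import Literature.Probability.RandomPlanarGeometry.SAWStripTM
import HarnessLib

/-!
# Evaluations of the strip transfer matrix for spans 2–5 (`native_decide`)

Topic `Literature/Probability/RandomPlanarGeometry`. Compiled evaluations of the fixed-point
weighted counts `StripTM.dp l 81 40` (`SAWStripTM.lean`: irreducible bridges of span `l` in the
`l × 81` grid with start row `40`, weight `⌊2⁶⁴ (5/13)^{|s|}⌋` summed with rounding down) for
`l = 2, 3, 4, 5`. Divided by `2⁶⁴` these are `0.0586977`, `0.0303683`, `0.0198911`, `0.0149473`,
the span-`l` contributions to Kesten's irreducible-bridge Kraft sum at fugacity `1/2.6`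
(Jensen 2004, §2, eq. (4); they agree to all digits with an independent C transfer matrix and, up
to length 22, with direct enumeration). The only non-standard axiom is `Lean.ofReduceBool`
(`native_decide`, declared `computational`); the four evaluations take ≈ 30 s together.

## References

* I. Jensen, *Improved lower bounds on the connective constants for two-dimensional self-avoiding
  walks*, J. Phys. A 37 (2004) 11521–11529, §2.
-/

namespace Literature.Probability.RandomPlanarGeometry.SAW.StripTM

/-- Span 2. [cite: Jensen2004SAWLowerBounds, §2] -/
theorem dp_two : dp 2 81 40 = 1082781387538051839 := by native_decide

/-- Span 3. [cite: Jensen2004SAWLowerBounds, §2] -/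
theorem dp_three : dp 3 81 40 = 560195840599135952 := by native_decide

/-- Span 4. [cite: Jensen2004SAWLowerBounds, §2] -/
theorem dp_four : dp 4 81 40 = 366925797437751625 := by native_decide

/-- Span 5. [cite: Jensen2004SAWLowerBounds, §2] -/
theorem dp_five : dp 5 81 40 = 275728550435343598 := by native_decide

end Literature.Probability.RandomPlanarGeometry.SAW.StripTM
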